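import Literature.GroupTheory.CombinatorialGroupTheory.AmalgamSlideChains
import Mathlib.Algebra.Order.Ring.Abs
import Mathlib.Algebra.Ring.Divisibility.Basic
import HarnessLib

/-!
# Transfer of non-conjugacy of cyclically reduced elements to a quotient amalgam (Dyer's Case 3)

Topic `Literature/GroupTheory/CombinatorialGroupTheory`; theorems only, continuing
`AmalgamConjugacyCriterion.lean` / `AmalgamSlideChains.lean`.  J. L. Dyer, *Separating conjugates in
amalgamated free products and HNN extensions*, J. Austral. Math. Soc. (A) 29 (1980), proof of Thm. 7,
Case 3 (pp.45–46), reused verbatim for Thm. 10 (free factors, p.48): for cyclically reduced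
`x = u₁⋯u_k`, `y = v₁⋯v_k` (`k ≥ 2`) in `P = (A * B : H)`, `H = ⟨h⟩` cyclic, and a quotient
`π : P → P̄ = (Ā * B̄ : H̄)` compatible with the factors, *"there exists a positive integer `n` such that
firstly for each `i`, `(I : i)` has a solution `h₀, …, h_k ∈ H` if and only if `π_n(I : i)` has a solution
… and secondly such that `π_n(u_k)`, `π_n(v_k)` are cyclically reduced … We claim that
`π_n(x) ≁ π_n(y)`"* — the closing exponent comparison (*"Multiply these equations over `i` to obtain
… the required contradiction"*) is done here MODULO AN INTEGER `L₀` exceeding twice a bound on the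
genuine exponents, which is the finite-quotient replacement (tree `FreeGroupCyclicIndependence`) of
Dyer's torsion-free nilpotent quotients.

* `not_isConj_lift_of_letterConditions` — **the transfer theorem**: let `q i : G i → G₂ i`, `q_H : H → H₂`
  be compatible homomorphisms of amalgam data (`φ₂` injective, `H₂` generated by `q_H c`), `x`, `y`
  cyclically reduced words of the same length `≥ 2` whose `q`-images have all letters off `φ₂(H₂)`.
  Suppose that for every letter pair `(u, v)` (a letter of a rotation of `x` against the letter of `y` in
  the same position): (i) if the sliding equation `c^m u = v c^{m'}` has no solution in `P` then its image
  has none in `P̄`; (ii) any solution `(n, n')` in `P̄` is congruent modulo `L₀` to any solution `(m, m')` in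
  `P`; (iii) solutions in `P` have `|m|, |m'| ≤ B`, where `2B < L₀`.  Then `x ≁ y` in `P` implies
  `π x ≁ π y` in `P̄`.

The three letter conditions are exactly what the tree's free-group bricks supply for `A`, `B` free and
`H = ⟨c⟩` malnormal: (i) `FreeGroup.exists_normal_finiteIndex_not_mem_doubleCoset` (cyclic double cosets,
Dyer's Lemma 9), (ii) `FreeGroup.exists_normal_finiteIndex_conj_zpow_mul_zpow_mem` (independence modulo
`L₀`), (iii) `Amalgam.slide_unique` (malnormality: at most one solution).

## References

* J. L. Dyer, *Separating conjugates in amalgamated free products and HNN extensions*, J. Austral.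
  Math. Soc. Ser. A 29 (1980) 35–51, Thm. 7 Case 3 pp.45–46, Thm. 10 p.48. [Dyer1980]
* W. Magnus, A. Karrass, D. Solitar, *Combinatorial Group Theory*, Interscience (1966), §4.2
  Thm. 4.6. [MagnusKarrassSolitar1966]
-/

namespace Literature.GroupTheory.CombinatorialGroupTheory

namespace Amalgam

open Monoid Monoid.PushoutI

variable {ι : Type*} {G : ι → Type*} [∀ i, Group (G i)] {H : Type*} [Group H]
  {φ : ∀ i, H →* G i}
  {G₂ : ι → Type*} [∀ i, Group (G₂ i)] {H₂ : Type*} [Group H₂] {φ₂ : ∀ i, H₂ →* G₂ i}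

/-- The value in `PushoutI φ` of a letter list. -/
local notation3 "ℓπ[" φ "] " l:max =>
  List.prod (List.map (fun x => Monoid.PushoutI.of (φ := φ) (Sigma.fst x) (Sigma.snd x)) l)

/-- The value in `PushoutI φ₂` of a letter list (quotient amalgam). -/
local notation3 "ℓπ₂ " l:max =>
  List.prod (List.map (fun x => Monoid.PushoutI.of (φ := φ₂) (Sigma.fst x) (Sigma.snd x)) l)

variable (qH : H →* H₂) (q : ∀ i, G i →* G₂ i)

/-- The letterwise image of a word under the factor homomorphisms `q`. -/
local notation3 "ℓq " w:max =>
  List.map (fun z : (Σ i, G i) => (⟨Sigma.fst z, q (Sigma.fst z) (Sigma.snd z)⟩ : Σ i, G₂ i)) w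

/-! ### The letterwise map (specialisations of `AmalgamSlideChains` to homomorphism families) -/

omit [Group H] [Group H₂] in
/-- The letterwise map preserves alternation. [cite: Dyer1980, Thm. 4 proof p.40] -/
private theorem isChain_lq {w : List (Σ i, G i)} (hw : w.IsChain fun a b => a.1 ≠ b.1) :
    (ℓq w).IsChain fun a b => a.1 ≠ b.1 :=
  (isChain_lmap_iff (fun i => q i) w).mpr hw

/-- The letterwise map keeps letters off the base group when told so. [cite: Dyer1980, Thm. 4 proof p.40] -/
private theorem offBase_lq {w : List (Σ i, G i)} (hw : ∀ z ∈ w, q z.1 z.2 ∉ (φ₂ z.1).range) :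
    ∀ z ∈ ℓq w, z.2 ∉ (φ₂ z.1).range := by
  intro z hz
  obtain ⟨z', hz', rfl⟩ := List.mem_map.mp hz
  exact hw z' hz'

omit [Group H] [Group H₂] in
/-- End letters of the letterwise image. [cite: Dyer1980, Thm. 4 proof p.40] -/
private theorem ends_lq {w : List (Σ i, G i)} (hcr : ∀ a ∈ w.getLast?, ∀ b ∈ w.head?, a.1 ≠ b.1) :
    ∀ a ∈ (ℓq w).getLast?, ∀ b ∈ (ℓq w).head?, a.1 ≠ b.1 :=
  ends_lmap (fun i => q i) hcr

omit [Group H] [Group H₂] in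
/-- The letterwise map commutes with rotation. [cite: Dyer1980, Thm. 4 proof p.40] -/
private theorem lq_rotate (w : List (Σ i, G i)) (k : ℕ) : ℓq (w.rotate k) = (ℓq w).rotate k :=
  lmap_rotate (fun i => q i) w k

omit [Group H] [Group H₂] in
/-- The letterwise map preserves the factor sequence. [cite: Dyer1980, Thm. 4 proof p.40] -/
private theorem map_fst_lq (w : List (Σ i, G i)) : (ℓq w).map Sigma.fst = w.map Sigma.fst :=
  map_fst_lmap (fun i => q i) w

/-- An integer divisible by `L₀` and of absolute value `< L₀` vanishes. [folklore] -/
private theorem int_eq_zero_of_dvd_of_abs_lt {L₀ : ℕ} {d : ℤ} (h : (L₀ : ℤ) ∣ d) (hd : |d| < L₀) :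
    d = 0 := by
  refine Int.eq_zero_of_dvd_of_natAbs_lt_natAbs h ?_
  rw [Int.natAbs_natCast]
  have := Int.natAbs_lt_natAbs_of_nonneg_of_lt (abs_nonneg d) hd
  rwa [Int.natAbs_abs, Int.natAbs_natCast] at this

/-- **Dyer's Case 3, abstract form: non-conjugacy of cyclically reduced words of length `≥ 2` descends
to a quotient amalgam under the three letter conditions** (no genuine sliding solution ⇒ none below;
solutions below ≡ genuine ones mod `L₀`; genuine exponents bounded by `B` with `2B < L₀`).
[cite: Dyer1980, Thm. 7 Case 3 p.45] -/
theorem not_isConj_lift_of_letterConditions (hφ₂ : ∀ i, Function.Injective (φ₂ i))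
    (c : H) (hgen : ∀ h₂ : H₂, ∃ n : ℤ, h₂ = qH c ^ n)
    {x y : List (Σ i, G i)} (hxc : x.IsChain fun a b => a.1 ≠ b.1) (hx2 : 2 ≤ x.length)
    (hxcr : ∀ a ∈ x.getLast?, ∀ b ∈ x.head?, a.1 ≠ b.1)
    (hyc : y.IsChain fun a b => a.1 ≠ b.1) (hycr : ∀ a ∈ y.getLast?, ∀ b ∈ y.head?, a.1 ≠ b.1)
    (hlen : y.length = x.length)
    (hxq : ∀ z ∈ x, q z.1 z.2 ∉ (φ₂ z.1).range) (hyq : ∀ z ∈ y, q z.1 z.2 ∉ (φ₂ z.1).range)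
    (L₀ B : ℕ) (hLB : 2 * B < L₀)
    (hletters : ∀ (r i : ℕ) (za zb : Σ i, G i), (x.rotate r)[i]? = some za → y[i]? = some zb →
      ((∀ m m' : ℤ, base φ (c ^ m) * of za.1 za.2 ≠ of zb.1 zb.2 * base φ (c ^ m')) →
          ∀ m m' : ℤ, base φ₂ (qH c ^ m) * of za.1 (q za.1 za.2) ≠
            of zb.1 (q zb.1 zb.2) * base φ₂ (qH c ^ m')) ∧
      (∀ n n' m m' : ℤ,
          base φ₂ (qH c ^ n) * of za.1 (q za.1 za.2) = of zb.1 (q zb.1 zb.2) * base φ₂ (qH c ^ n') →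
          base φ (c ^ m) * of za.1 za.2 = of zb.1 zb.2 * base φ (c ^ m') →
          (L₀ : ℤ) ∣ n - m ∧ (L₀ : ℤ) ∣ n' - m') ∧
      (∀ m m' : ℤ, base φ (c ^ m) * of za.1 za.2 = of zb.1 zb.2 * base φ (c ^ m') →
          |m| ≤ B ∧ |m'| ≤ B))
    (hxy : ¬ IsConj (ℓπ[φ] x) (ℓπ[φ] y)) :
    ¬ IsConj (ℓπ₂ (ℓq x)) (ℓπ₂ (ℓq y)) := by
  classical
  intro hc
  set K := x.length with hK
  -- the images are cyclically reduced words of length `K ≥ 2`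
  have hxc₂ := isChain_lq q hxc
  have hyc₂ := isChain_lq q hyc
  have hxr₂ := offBase_lq q hxq
  have hyr₂ := offBase_lq q hyq
  have hx2₂ : 2 ≤ (ℓq x).length := by simpa using hx2
  have hxcr₂ := ends_lq q hxcr
  have hycr₂ := ends_lq q hycr
  -- rotation form of conjugacy downstairs
  obtain ⟨c₀, k, hk, e⟩ := exists_rotate_of_isConj hφ₂ hxc₂ hxr₂ hx2₂ hxcr₂ hyc₂ hyr₂ hycr₂ hc
  rw [List.length_map] at hk
  -- `y = y₁ ++ [zk]`; absorb `c₀` into the last letter of the image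
  have hyne : y ≠ [] := by rintro rfl; simp at hlen; omega
  obtain ⟨y₁, zk, hy⟩ : ∃ y₁ zk, y = y₁ ++ [zk] :=
    ⟨y.dropLast, y.getLast hyne, (List.dropLast_append_getLast hyne).symm⟩
  have hy₁ : y₁.length + 1 = K := by
    have h1 := congrArg List.length hy
    rw [List.length_append, List.length_singleton] at h1
    omega
  set Y : List (Σ i, G₂ i) := ℓq y₁ ++ [⟨zk.1, q zk.1 zk.2 * φ₂ zk.1 c₀⟩] with hY
  -- the rotated word upstairs
  set xr := x.rotate k with hxr'
  have hYval : ℓπ₂ Y = base φ₂ c₀ * ℓπ₂ (ℓq xr) := by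
    have e1 : ℓπ₂ (ℓq y) * base φ₂ c₀ = ℓπ₂ Y := by
      rw [hy, List.map_append, List.map_singleton, lprod_concat_mul_base, hY]
    rw [← e1, e, hxr', lq_rotate]
    group
  have hYfst : Y.map Sigma.fst = y.map Sigma.fst := by
    rw [hY, hy, List.map_append, List.map_append, map_fst_lq]; rfl
  have hYc : Y.IsChain (fun a b => a.1 ≠ b.1) := by
    have h1 : (y.map Sigma.fst).IsChain (· ≠ ·) := (List.isChain_map Sigma.fst).mpr hyc
    rw [← hYfst] at h1
    exact (List.isChain_map Sigma.fst).mp h1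
  have hYr : ∀ z ∈ Y, z.2 ∉ (φ₂ z.1).range := by
    intro z hz
    rw [hY, List.mem_append, List.mem_singleton] at hz
    rcases hz with hz | rfl
    · obtain ⟨z', hz', rfl⟩ := List.mem_map.mp hz
      exact hyq z' (by rw [hy]; exact List.mem_append_left _ hz')
    · simpa using mul_not_mem_range (hyq zk (by rw [hy]; simp)) 1 c₀
  have hxrc₂ : (ℓq xr).IsChain (fun a b => a.1 ≠ b.1) := isChain_lq q (isChain_rotate hxc hxcr k)
  have hxrr₂ : ∀ z ∈ ℓq xr, z.2 ∉ (φ₂ z.1).range :=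
    offBase_lq q (fun z hz => hxq z (List.mem_rotate.mp hz))
  have hfst : (ℓq xr).map Sigma.fst = Y.map Sigma.fst :=
    (map_fst_eq_of_lprod_eq hφ₂ hYc hYr hxrc₂ hxrr₂ c₀ hYval).symm
  -- the downstairs chain `c₀ = g 0, g 1, …, g K = 1`
  obtain ⟨hs, hslen, hsh, hsl, hseq⟩ :=
    exists_chain_of_lprod_eq hφ₂ (ℓq xr) Y c₀ hxrc₂ hxrr₂ hYc hYr hfst hYval
  rw [List.length_map, hxr', List.length_rotate] at hslen
  have hYlen : Y.length = K := by
    rw [hY, List.length_append, List.length_map, List.length_singleton]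
    have : y₁.length + 1 = y.length := by rw [hy, List.length_append, List.length_singleton]
    omega
  have hxrlen : xr.length = K := by rw [hxr', List.length_rotate]
  -- letters and chain elements as functions of the position
  let d : Σ i, G i := zk
  let za : ℕ → Σ i, G i := fun i => (xr[i]?).getD d
  let zb : ℕ → Σ i, G i := fun i => (y[i]?).getD d
  let g : ℕ → H₂ := fun i => (hs[i]?).getD 1
  have hza : ∀ i, i < K → xr[i]? = some (za i) := fun i hi => by
    simp only [za, List.getElem?_eq_getElem (show i < xr.length by omega), Option.getD_some]
  have hzb : ∀ i, i < K → y[i]? = some (zb i) := fun i hi => by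
    simp only [zb, List.getElem?_eq_getElem (show i < y.length by omega), Option.getD_some]
  have hg : ∀ i, i ≤ K → hs[i]? = some (g i) := fun i hi => by
    simp only [g, List.getElem?_eq_getElem (show i < hs.length by omega), Option.getD_some]
  have hg0 : g 0 = c₀ := by
    have := hg 0 (by omega); rw [← List.head?_eq_getElem?, hsh] at this
    exact (Option.some.inj this).symm
  have hgK : g K = 1 := by
    have h1 := hg K le_rfl
    have h2 : hs.getLast? = hs[K]? := by rw [List.getLast?_eq_getElem?, hslen, Nat.add_sub_cancel]
    rw [← h2, hsl] at h1
    exact (Option.some.inj h1).symm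
  -- letters of the downstairs words
  have hxrq : ∀ i, i < K →
      (ℓq xr)[i]? = some ⟨(za i).1, q (za i).1 (za i).2⟩ := fun i hi => by
    rw [List.getElem?_map, hza i hi]; rfl
  have hYq : ∀ i, i + 1 < K → Y[i]? = some ⟨(zb i).1, q (zb i).1 (zb i).2⟩ := fun i hi => by
    have h1 : Y[i]? = (ℓq y₁)[i]? := by
      rw [hY]; exact List.getElem?_append_left (by rw [List.length_map]; omega)
    have h2 : y[i]? = y₁[i]? := by rw [hy]; exact List.getElem?_append_left (by omega)
    rw [h1, List.getElem?_map, ← h2, hzb i (by omega)]; rfl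
  have hYlast : Y[K - 1]? = some ⟨zk.1, q zk.1 zk.2 * φ₂ zk.1 c₀⟩ := by
    have h1 : y₁.length = K - 1 := by
      have : y₁.length + 1 = y.length := by rw [hy, List.length_append, List.length_singleton]
      omega
    rw [hY, List.getElem?_append_right (by rw [List.length_map]; omega), List.length_map, h1,
      Nat.sub_self, List.getElem?_cons_zero]
  have hzbK : zb (K - 1) = zk := by
    have h1 : y[K - 1]? = some zk := by
      have : y₁.length = K - 1 := by
        have : y₁.length + 1 = y.length := by rw [hy, List.length_append, List.length_singleton]
        omega
      rw [hy, List.getElem?_append_right (by omega), this, Nat.sub_self, List.getElem?_cons_zero]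
    have h2 := hzb (K - 1) (by omega)
    rw [h1] at h2
    exact (Option.some.inj h2).symm
  -- exponents of the chain; the last sliding element is `g K = 1`, so the last equation closes on
  -- `c₀ = g 0 = c̄ ^ (n 0)`
  have hn : ∀ i, ∃ n : ℤ, g i = qH c ^ n := fun i => hgen (g i)
  choose n hn using hn
  let f : ℕ → ℤ := fun i => if i + 1 < K then n (i + 1) else n 0
  -- the downstairs sliding equations, position by position
  have down : ∀ i, i < K →
      base φ₂ (qH c ^ n i) * of (za i).1 (q (za i).1 (za i).2) =
        of (zb i).1 (q (zb i).1 (zb i).2) * base φ₂ (qH c ^ f i) := by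
    intro i hi
    by_cases hi1 : i + 1 < K
    · have h1 := hseq i _ _ (g i) (g (i + 1)) (hxrq i hi) (hYq i hi1)
        (hg i hi.le) (hg (i + 1) (by omega))
      simp only [f, if_pos hi1, ← hn]
      exact h1
    · have hiK : i = K - 1 := by omega
      subst hiK
      have h1 := hseq (K - 1) _ ⟨zk.1, q zk.1 zk.2 * φ₂ zk.1 c₀⟩ (g (K - 1))
        (g (K - 1 + 1)) (hxrq _ hi) hYlast (hg _ hi.le) (hg _ (by omega))
      rw [show K - 1 + 1 = K by omega, hgK, map_one, mul_one] at h1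
      simp only [f, if_neg hi1]
      rw [← hn (K - 1), h1, hzbK, map_mul, of_apply_eq_base, ← hn 0, hg0]
  -- genuine solutions exist at every position (condition (i), contrapositive)
  have up : ∀ i, ∃ mm : ℤ × ℤ, i < K →
      base φ (c ^ mm.1) * of (za i).1 (za i).2 = of (zb i).1 (zb i).2 * base φ (c ^ mm.2) := by
    intro i
    by_cases hi : i < K
    · by_contra hne
      push Not at hne
      have h1 := (hletters k i (za i) (zb i) (hza i hi) (hzb i hi)).1
        (fun m m' => (hne (m, m')).2) (n i) (f i)
      exact h1 (down i hi)
    · exact ⟨(0, 0), fun h => absurd h hi⟩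
  choose mm hmm using up
  -- congruences (condition (ii)) and bounds (condition (iii))
  have hcong : ∀ i, i < K → (L₀ : ℤ) ∣ n i - (mm i).1 ∧ (L₀ : ℤ) ∣ f i - (mm i).2 := fun i hi =>
    (hletters k i (za i) (zb i) (hza i hi) (hzb i hi)).2.1 _ _ _ _ (down i hi) (hmm i hi)
  have hbd : ∀ i, i < K → |(mm i).1| ≤ B ∧ |(mm i).2| ≤ B := fun i hi =>
    (hletters k i (za i) (zb i) (hza i hi) (hzb i hi)).2.2 _ _ (hmm i hi)
  have hBL : ((B : ℤ) + B) < L₀ := by exact_mod_cast (show B + B < L₀ by omega)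
  -- two genuine exponents congruent mod `L₀` are equal
  have heq_of_dvd : ∀ i j, i < K → j < K → (L₀ : ℤ) ∣ (mm j).1 - (mm i).2 → (mm i).2 = (mm j).1 := by
    intro i j hi hj hdvd
    have ha := abs_le.mp (hbd j hj).1
    have hb := abs_le.mp (hbd i hi).2
    have h4 : |(mm j).1 - (mm i).2| < L₀ := abs_lt.mpr ⟨by omega, by omega⟩
    have := int_eq_zero_of_dvd_of_abs_lt hdvd h4
    omega
  -- consecutive genuine exponents agree, and the chain closes up
  have hnext : ∀ i, i < K →
      (mm i).2 = (mm (if i + 1 < K then i + 1 else 0)).1 := by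
    intro i hi
    have h1 := (hcong i hi).2
    by_cases hi1 : i + 1 < K
    · simp only [f, if_pos hi1] at h1
      rw [if_pos hi1]
      refine heq_of_dvd i (i + 1) hi hi1 ?_
      have := dvd_sub h1 (hcong (i + 1) hi1).1
      rwa [sub_sub_sub_cancel_left] at this
    · simp only [f, if_neg hi1] at h1
      rw [if_neg hi1]
      refine heq_of_dvd i 0 hi (by omega) ?_
      have := dvd_sub h1 (hcong 0 (by omega)).1
      rwa [sub_sub_sub_cancel_left] at this
  -- the upstairs chain `c^{m_0}, …, c^{m_{K-1}}, c^{m_0}` conjugates `ℓπ xr` to `ℓπ y`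
  let e : ℕ → ℤ := fun i => (mm (if i < K then i else 0)).1
  let ms : List H := (List.range (K + 1)).map fun i => c ^ e i
  have hms : ∀ i, i ≤ K → ms[i]? = some (c ^ e i) := fun i hi => by
    simp only [ms, List.getElem?_map, List.getElem?_range (show i < K + 1 by omega), Option.map_some]
  have key : IsConj (ℓπ[φ] xr) (ℓπ[φ] y) := by
    refine isConj_lprod_of_chain xr y ms (c ^ e 0) ?_ ?_ ?_ ?_ ?_
    · simp only [ms, List.length_map, List.length_range, hxrlen]
    · rw [hlen, hxrlen]
    · rw [List.head?_eq_getElem?]; exact hms 0 (by omega)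
    · have hl : ms.length = K + 1 := by simp [ms]
      rw [List.getLast?_eq_getElem?, hl, Nat.add_sub_cancel, hms K le_rfl]
      simp [e, show (0 : ℕ) < K from by omega]
    · intro i za' zb' a b hu hv ha hb
      have hi : i < K := by
        rw [← hxrlen]; exact (List.getElem?_eq_some_iff.mp hu).1
      rw [hza i hi] at hu
      rw [hzb i hi] at hv
      rw [hms i hi.le] at ha
      rw [hms (i + 1) (by omega)] at hb
      obtain rfl := Option.some.inj hu
      obtain rfl := Option.some.inj hv
      obtain rfl := Option.some.inj ha
      obtain rfl := Option.some.inj hb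
      have h1 := hmm i hi
      have h2 := hnext i hi
      have he0 : e i = (mm i).1 := by simp only [e, if_pos hi]
      have he1 : e (i + 1) = (mm i).2 := by rw [h2]
      rw [he0, he1]
      exact h1
  -- `ℓπ x ~ ℓπ xr`
  have hrot : IsConj (ℓπ[φ] x) (ℓπ[φ] xr) := by
    refine isConj_iff.mpr ⟨ℓπ[φ] (x.drop k), ?_⟩
    rw [hxr']
    exact lprod_drop_mul_lprod_mul_inv x hk.le
  exact hxy (hrot.trans key)

end Amalgam

end Literature.GroupTheory.CombinatorialGroupTheory
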